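import Mathlib
import Summits.Ventures.PercRepro2.V2SP
import Summits.Ventures.PercRepro2.Tail2DP2SeriesSP
import Summits.Ventures.PercRepro2.Tail2DCellUnimodal
import Summits.Ventures.PercRepro2.Tail2DPathFlip

/-!
# Cellwise unimodality as a statement about average path counts (pin-free patterns)
(seat mine-b, cell pub-perc-repro2; MINE-B.md §39.9)

On a pattern without pins every configuration with blue flow `≥ 1` has a blue s–t path through free edges
(`exists_bluePath`), so the total blue-path count of a cell `(i,b)`, `b ≥ 1`, is at least `N(i,b)`.  With the
exact identity `card_bluePaths_eq` (`Σ_{(i,b)} #bluePaths = Σ_{(i+1,b−1)} #redPaths`) and the colour swap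
(`sum_redPaths_swap`: the red-path total of a cell is the blue-path total of the mirror cell) the cellwise
inequality `N(i,b) ≤ N(i+1,b−1)` is equivalent to a comparison of AVERAGE blue-path counts at mirror cells:

  `N(i,b) ≤ N(i+1,b−1)  ⟺  Σ_{(b−1,i+1)} #bluePaths · N(i,b) ≤ Σ_{(i,b)} #bluePaths · N(i+1,b−1)`

(`cau_iff_avg`), i.e. `avg_B(b−1, i+1) ≤ avg_B(i, b)` — a configuration at the bluer of two mirror cells
carries, on average, at least as many blue paths.
-/

namespace Summit.Ventures.PercRepro2.Tail2D

open V2Closure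

/-- patterns without pins (free edges, absent edges, compositions) -/
inductive PinFree : V2Closure.SP → Prop
  | free : PinFree .free
  | absent : PinFree .absent
  | ser {s t : V2Closure.SP} : PinFree s → PinFree t → PinFree (.ser s t)
  | par {s t : V2Closure.SP} : PinFree s → PinFree t → PinFree (.par s t)

/-- on a pin-free pattern a configuration with blue flow `≥ 1` has a blue path -/
theorem exists_bluePath : ∀ {s : V2Closure.SP}, PinFree s → ∀ x : s.Conf, 1 ≤ s.bLab x → Nonempty (bluePaths s x)
  | .free, _, c, hc => by
    cases c
    · simp [SP.bLab] at hc
    · exact ⟨(⟨0, by decide⟩ : Fin (if true = true then 1 else 0))⟩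
  | .absent, _, _, hc => by simp [SP.bLab] at hc
  | .ser s t, .ser hs ht, p, hc => by
    simp only [SP.bLab, serB] at hc
    obtain ⟨q₁⟩ := exists_bluePath hs p.1 (by omega)
    obtain ⟨q₂⟩ := exists_bluePath ht p.2 (by omega)
    exact ⟨(q₁, q₂)⟩
  | .par s t, .par hs ht, p, hc => by
    simp only [SP.bLab, parB] at hc
    rcases (by omega : 1 ≤ s.bLab p.1 ∨ 1 ≤ t.bLab p.2) with h | h
    · obtain ⟨q⟩ := exists_bluePath hs p.1 h; exact ⟨Sum.inl q⟩
    · obtain ⟨q⟩ := exists_bluePath ht p.2 h; exact ⟨Sum.inr q⟩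

/-- the blue-path total of a cell with `b ≥ 1` on a pin-free pattern is at least the cell count -/
theorem ncell_le_sum_bluePaths {s : V2Closure.SP} (hs : PinFree s) (i b : ℕ) (hb : 1 ≤ b) :
    ncell s i b ≤ ∑ x ∈ Finset.univ.filter (fun x : s.Conf => s.rLab x = i ∧ s.bLab x = b), Fintype.card (bluePaths s x) := by
  unfold ncell
  rw [Finset.card_eq_sum_ones]
  refine Finset.sum_le_sum (fun x hx => ?_)
  simp only [Finset.mem_filter, Finset.mem_univ, true_and] at hx
  have := exists_bluePath hs x (by omega)
  exact Fintype.card_pos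

/-- the red paths of the swapped configuration are the blue paths: `#redPaths (swap x) = #bluePaths x` -/
theorem card_redPaths_swap : ∀ (s : V2Closure.SP) (x : s.Conf),
    Fintype.card (redPaths s (swapConf s x)) = Fintype.card (bluePaths s x)
  | .free, c => by cases c <;> rfl
  | .pin, _ => rfl
  | .absent, _ => rfl
  | .ser s t, p => by
    show Fintype.card (redPaths s (swapConf s p.1) × redPaths t (swapConf t p.2)) = Fintype.card (bluePaths s p.1 × bluePaths t p.2)
    rw [Fintype.card_prod, Fintype.card_prod, card_redPaths_swap s p.1, card_redPaths_swap t p.2]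
  | .par s t, p => by
    show Fintype.card (redPaths s (swapConf s p.1) ⊕ redPaths t (swapConf t p.2)) = Fintype.card (bluePaths s p.1 ⊕ bluePaths t p.2)
    rw [Fintype.card_sum, Fintype.card_sum, card_redPaths_swap s p.1, card_redPaths_swap t p.2]

/-- the red-path total of the cell `(a,c)` is the blue-path total of the mirror cell `(c,a)` -/
theorem sum_redPaths_swap (s : V2Closure.SP) (a c : ℕ) :
    ∑ x ∈ Finset.univ.filter (fun x : s.Conf => s.rLab x = a ∧ s.bLab x = c), Fintype.card (redPaths s x)
      = ∑ x ∈ Finset.univ.filter (fun x : s.Conf => s.rLab x = c ∧ s.bLab x = a), Fintype.card (bluePaths s x) := by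
  refine Finset.sum_nbij' (swapConf s) (swapConf s) ?_ ?_ ?_ ?_ ?_
  · intro x hx; simp only [Finset.mem_filter, Finset.mem_univ, true_and, rLab_swapConf, bLab_swapConf] at hx ⊢; exact ⟨hx.2, hx.1⟩
  · intro x hx; simp only [Finset.mem_filter, Finset.mem_univ, true_and, rLab_swapConf, bLab_swapConf] at hx ⊢; exact ⟨hx.2, hx.1⟩
  · intro x _; exact swapConf_swapConf s x
  · intro x _; exact swapConf_swapConf s x
  · intro x _
    have := card_redPaths_swap s (swapConf s x)
    rw [swapConf_swapConf] at this
    exact this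

/-- **cellwise unimodality is the average-path comparison at mirror cells** (pin-free patterns, `b ≥ 1`):
`N(i,b) ≤ N(i+1,b−1)` iff `(Σ_{(b−1,i+1)} #bluePaths)·N(i,b) ≤ (Σ_{(i,b)} #bluePaths)·N(i+1,b−1)` -/
theorem cau_iff_avg {s : V2Closure.SP} (hs : PinFree s) (i b : ℕ) (hb : 1 ≤ b) :
    ncell s i b ≤ ncell s (i + 1) (b - 1)
      ↔ (∑ x ∈ Finset.univ.filter (fun x : s.Conf => s.rLab x = b - 1 ∧ s.bLab x = i + 1), Fintype.card (bluePaths s x))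
            * ncell s i b
        ≤ (∑ x ∈ Finset.univ.filter (fun x : s.Conf => s.rLab x = i ∧ s.bLab x = b), Fintype.card (bluePaths s x))
            * ncell s (i + 1) (b - 1) := by
  have hid := card_bluePaths_eq s i b hb
  rw [sum_redPaths_swap] at hid
  -- write S := the blue-path total of (i,b) = the blue-path total of the mirror cell (b−1, i+1)
  rw [← hid]
  constructor
  · intro h; exact Nat.mul_le_mul_left _ h
  · intro h
    have hpos : 0 < ∑ x ∈ Finset.univ.filter (fun x : s.Conf => s.rLab x = i ∧ s.bLab x = b), Fintype.card (bluePaths s x) ∨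
        ncell s i b = 0 := by
      rcases Nat.eq_zero_or_pos (ncell s i b) with h0 | h0
      · exact Or.inr h0
      · exact Or.inl (lt_of_lt_of_le h0 (ncell_le_sum_bluePaths hs i b hb))
    rcases hpos with hp | h0
    · exact Nat.le_of_mul_le_mul_left h hp
    · rw [h0]; exact Nat.zero_le _

end Summit.Ventures.PercRepro2.Tail2D
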